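import Summits.CriticalPhenomena.PercolationContinuityZ3.Theorems.PercNearOneGluingNoHeavyLowerTailSahiLogDerivEndC3

/-!
# Sahi's `C_3` on product measures from the TWO-LEVEL form ("C₃-M⁻") alone — the measure-level sufficient conditions,
# named and proved to imply Kahn's Conjecture 5

Support file of the one-cut programme (crux `NoHeavyLowerTail`, stmt-CriticalPhenomena-4575; cell `prim-bnk`, seat bnk-2 gen 8,
memo `run/shared/lean/prim/prim-l12/FROM-prim-bnk-2-g8-TWO-LEVEL-C3.md`; INEQ-CLAIMS rows COMB-M-E3, S2-GRAPH).

For a triple `U` of increasing events and a coordinate `a` write `G_i = U_i^{a←1} ⊇ H_i = U_i^{a←0}` for the sections (nested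
increasing events).  prim-ineq-gen-4 g5 (memo `run/shared/lean/prim/prim-ineq-gen-4/FINDING-PRODUCT-FORM-SAHI-g5.md` §II; ring
identities `…SahiE3TwoLevel.sahiE3_M_minus_form / sahiE3_M_plus_form`) wrote the endpoint quantity `2Φ(0) + Φ′(0) = 3β₁ − β₀` of the
log-derivative schema as the TWO-LEVEL FORM in the fourteen moments `P(∩_{i∈B} H_i)`, `P(∩_{i∈B} G_i)`,
  `T(G,H) = 2P(H₀H₁H₂) + 2P(G₀G₁G₂) − P(H₀)P(H₁)P(H₂) + Σ_cyc P(G_i)P(H_j)P(H_k) − Σ_cyc [P(G_i)P(H_jH_k) + P(H_i)P(G_jG_k)]`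
(`twoLevelForm`), and observed that "C₃-M⁻" — `T ≥ 0` for all nested sextuples of increasing events under product measures — would
give Sahi's `C_3` on product measures.  That implication is formalised here (via `…SahiLogDerivEndC3`):
* `SahiTwoLevelMinus` / `SahiTwoLevelPlus` — the two measure-level conjectures (`3β₁ ≥ β₀`, resp. `3β₂ ≥ β₃`, i.e.
  `T(G,H) − ∏_i (P(G_i) − P(H_i)) ≥ 0`); `sahiTwoLevelMinus_of_plus`: TOP is the stronger side;
* `SahiTwoLevel.twoLevelForm_secAt_eq` — `T(U^{a←1}, U^{a←0}) = 2Φ(0) + Φ′(0)` (section moments = probabilities of sections);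
* **`masterFamilyNonneg_three_of_sahiTwoLevelMinus`**, **`kahnConjecture_of_sahiTwoLevelMinus`** (and `…Plus`, and the decreasing
  version): C₃-M⁻ ⟹ `MasterFamilyNonneg 3` ⟺ Kahn's Conjecture 5.  These are the WEAKEST sufficient conditions recorded in the
  programme: comb `c_0 ≤ c_1` (this gen) ⟹ `SahiTwoLevelMinus`-at-sections; comb `c_3 ≤ c_2` (gen 7) / `CombOrderTwoTop 3` (gen 6) ⟹
  `SahiTwoLevelPlus`-at-sections ⟹ the former.
Census: contained in the exhaustive comb laws for `E_3` on `m ≤ 5` coordinates (all nested pairs on `≤ 4` coordinates, all `q`);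
`0` violations in every sample (nested pairs on `≤ 5` coordinates, graph arrays, sparse supports).  Everything here is proved; axioms
standard; `C_3`, `SahiTwoLevelMinus`, `SahiTwoLevelPlus` remain OPEN (obligations of our theories, never facts). [this work]
-/

noncomputable section

open scoped Classical

namespace Summit.CriticalPhenomena.PercolationContinuityZ3.Theorems

open Finset Function
open Literature.Combinatorics.Sahi2008
open Literature.Probability.LatticeModels (prodBernoulli)
open Literature.Probability.Percolation.BHK2006 (ind_inter)
open Literature.Probability.Percolation.DecisionTree (ind ind_of_mem ind_of_not_mem ind_nonneg)
open SahiLogDerivEnd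

/-! ### The two-level form and the two measure-level conjectures -/

section Statement

variable {κ : Type*}

/-- **The two-level form** `T(G,H)` of two triples of events under a set function `P` (prim-ineq-gen-4 g5 §II "C₃-M⁻";
`…SahiE3TwoLevel.sahiE3_M_minus_form` with `e⁰ = P(H₀H₁H₂)`, `e¹ = P(G₀G₁G₂)`, `aᵢ⁰ = P(Hᵢ)`, `aᵢ¹ = P(Gᵢ)`, `bᵢ⁰ = P(H_jH_k)`,
`bᵢ¹ = P(G_jG_k)`):
`2P(H₀H₁H₂) + 2P(G₀G₁G₂) − P(H₀)P(H₁)P(H₂) + Σ_cyc P(G_i)P(H_j)P(H_k) − Σ_cyc [P(G_i)P(H_j ∩ H_k) + P(H_i)P(G_j ∩ G_k)]`.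
For the sections `G = U^{a←1}`, `H = U^{a←0}` of a triple along a coordinate `a` of a product measure it equals `2Φ(0) + Φ′(0)`
(`= 3β₁ − β₀` in Bernstein form) for the fibre cubic `Φ` (`twoLevelForm_secAt_eq`). [this work] -/
def twoLevelForm (P : Set (Set κ) → ℝ) (G H : Fin 3 → Set (Set κ)) : ℝ :=
  2 * P (H 0 ∩ H 1 ∩ H 2) + 2 * P (G 0 ∩ G 1 ∩ G 2) - P (H 0) * P (H 1) * P (H 2)
    + (P (G 0) * P (H 1) * P (H 2) + P (H 0) * P (G 1) * P (H 2) + P (H 0) * P (H 1) * P (G 2))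
    - (P (G 0) * P (H 1 ∩ H 2) + P (G 1) * P (H 0 ∩ H 2) + P (G 2) * P (H 0 ∩ H 1))
    - (P (H 0) * P (G 1 ∩ G 2) + P (H 1) * P (G 0 ∩ G 2) + P (H 2) * P (G 0 ∩ G 1))

end Statement

/-- **Conjecture C₃-M⁻ (the two-level BOTTOM law, `3β₁ ≥ β₀`)** (prim-ineq-gen-4 g5 §II; INEQ-CLAIMS row COMB-M-E3, measure level):
for every finite cube, every product measure `μ_q` and all NESTED triples `H_i ⊆ G_i` of increasing events,
`0 ≤ twoLevelForm μ_q G H`.  Equivalently: along every coordinate of every triple of increasing events `2E_3 + (1−q_a)∂E_3/∂q_a ≥ 0`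
at `q_a = 0` (every nested pair is the pair of sections of `U_i = {a ∈ ω, ω ∈ G_i} ∪ {ω ∈ H_i}`).  Implies `C_3` on product measures
(`masterFamilyNonneg_three_of_sahiTwoLevelMinus`).  Census: contained in the exhaustive comb law `c_0 ≤ c_1` for `E_3` on `m ≤ 5`
coordinates (ttrl topform RESULT 5), i.e. verified for all nested pairs on `≤ 4` coordinates and all `q`; `0` violations in every
sample.  OPEN; an obligation of our theories, never a fact. [this work] [status: open] -/
@[conjecture] def SahiTwoLevelMinus : Prop :=
  ∀ (κ : Type) [Fintype κ] (q : κ → unitInterval) (G H : Fin 3 → Set (Set κ)),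
    (∀ i, IsUpperSet (G i)) → (∀ i, IsUpperSet (H i)) → (∀ i, H i ⊆ G i) →
      0 ≤ twoLevelForm (fun A => (prodBernoulli q).real A) G H

/-- **Conjecture C₃-M⁺ (the two-level TOP law, `3β₂ ≥ β₃`)**: `0 ≤ twoLevelForm μ_q G H − ∏_i (μ_q(G_i) − μ_q(H_i))` for all nested
triples of increasing events (`…SahiE3TwoLevel.sahiE3_M_plus_form`: `3β₂ − β₃ = (3β₁ − β₀) − δ₁δ₂δ₃`).  The STRONGER side
(`sahiTwoLevelMinus_of_plus`); it is the measure-level shadow of the comb law `c_3 ≤ c_2` (gen 7) and of `CombOrderTwoTop 3` (gen 6).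
OPEN; an obligation, never a fact. [this work] [status: open] -/
@[conjecture] def SahiTwoLevelPlus : Prop :=
  ∀ (κ : Type) [Fintype κ] (q : κ → unitInterval) (G H : Fin 3 → Set (Set κ)),
    (∀ i, IsUpperSet (G i)) → (∀ i, IsUpperSet (H i)) → (∀ i, H i ⊆ G i) →
      0 ≤ twoLevelForm (fun A => (prodBernoulli q).real A) G H - ∏ i, ((prodBernoulli q).real (G i) - (prodBernoulli q).real (H i))

/-- **Top ⟹ bottom at the measure level**: the product of the three (nonnegative) increments is subtracted. [this work] -/
theorem sahiTwoLevelMinus_of_plus (h : SahiTwoLevelPlus) : SahiTwoLevelMinus := by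
  intro κ _ q G H hG hH hHG
  have hprod : 0 ≤ ∏ i, ((prodBernoulli q).real (G i) - (prodBernoulli q).real (H i)) :=
    prod_nonneg fun i _ => sub_nonneg.2 (MeasureTheory.measureReal_mono (hHG i))
  linarith [h κ q G H hG hH hHG]

namespace SahiTwoLevel


/-! ### Section moments are probabilities of sections; the two-level form of the sections is `2Φ(0) + Φ′(0)` -/

section Sections

variable {κ : Type*} [Fintype κ]

/-- **Section moments are expectations of section indicators**: `X_b(1_A) = μ_q(A^{a←b})`. [this work] -/
theorem secEx_ind_eq_ex_secAt (q : κ → unitInterval) (a : κ) (A : Set (Set κ)) (b : Bool) :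
    secEx q a (ind A) b = ex (bernoulliWeight q) (ind (secAt a b A)) := by
  have h1 := ex_ind_update_boolParam q a b A
  rw [ex_update_eq, ex_update_eq_of_ignores q a (boolParam b) (q a) (ind_secAt_insert a b A), update_eq_self] at h1
  rw [← h1]
  cases b <;> simp [boolParam]

omit [Fintype κ] in
/-- `1_A · 1_B = 1_{A ∩ B}` as functions. [folklore] -/
theorem ind_mul_ind (A B : Set (Set κ)) : ind A * ind B = ind (A ∩ B) :=
  funext fun ω => (ind_inter A B ω).symm

/-- **The two-level form of the sections is the endpoint quantity of the schema**:
`twoLevelForm μ_q (U^{a←1}) (U^{a←0}) = 2Φ(0) + Φ′(0)`. [this work] -/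
theorem twoLevelForm_secAt_eq (q : κ → unitInterval) (a : κ) (U : Fin 3 → Set (Set κ)) :
    twoLevelForm (fun A => ex (bernoulliWeight q) (ind A)) (fun i => secAt a true (U i)) (fun i => secAt a false (U i)) =
      2 * cubicE3 q a (ind (U 0)) (ind (U 1)) (ind (U 2)) 0 + derivE3AtZero q a (ind (U 0)) (ind (U 1)) (ind (U 2)) := by
  simp only [twoLevelForm, ← secAt_inter, ← secEx_ind_eq_ex_secAt, ← ind_mul_ind, cubicE3, derivE3AtZero]
  ring

/-- The same with probabilities written as `(prodBernoulli q).real`. [this work] -/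
theorem twoLevelForm_secAt_eq' (q : κ → unitInterval) (a : κ) (U : Fin 3 → Set (Set κ)) :
    twoLevelForm (fun A => (prodBernoulli q).real A) (fun i => secAt a true (U i)) (fun i => secAt a false (U i)) =
      2 * cubicE3 q a (ind (U 0)) (ind (U 1)) (ind (U 2)) 0 + derivE3AtZero q a (ind (U 0)) (ind (U 1)) (ind (U 2)) := by
  rw [← twoLevelForm_secAt_eq]
  simp only [ex_bernoulliWeight_ind]

omit [Fintype κ] in
/-- The `0`-section of an increasing event is contained in its `1`-section. [folklore] -/
theorem secAt_false_subset_true (a : κ) {A : Set (Set κ)} (hA : IsUpperSet A) : secAt a false A ⊆ secAt a true A := by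
  intro ω hω
  rw [mem_secAt] at hω ⊢
  refine hA ?_ hω
  simp only [forceAt, cond_false, cond_true]
  exact fun i hi => Set.mem_insert_of_mem a hi.1

/-- **C₃-M⁻ supplies the endpoint inequality** `2Φ(0) + Φ′(0) ≥ 0` along every axis of every triple of increasing events. [this work] -/
theorem logDerivEnd_nonneg_of_sahiTwoLevelMinus (h : SahiTwoLevelMinus) {κ : Type} [Fintype κ] (q : κ → unitInterval)
    (U : Fin 3 → Set (Set κ)) (hU : ∀ i, IsUpperSet (U i)) (a : κ) :
    0 ≤ 2 * cubicE3 q a (ind (U 0)) (ind (U 1)) (ind (U 2)) 0 + derivE3AtZero q a (ind (U 0)) (ind (U 1)) (ind (U 2)) := by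
  rw [← twoLevelForm_secAt_eq']
  exact h κ q _ _ (fun i => isUpperSet_secAt a true (hU i)) (fun i => isUpperSet_secAt a false (hU i))
    fun i => secAt_false_subset_true a (hU i)

end Sections

end SahiTwoLevel

open SahiTwoLevel

/-- **C₃-M⁻ ⟹ SAHI'S `C_3` ON PRODUCT MEASURES.**  If the two-level form is nonnegative for all nested triples of increasing events
under every product measure on every finite cube (`SahiTwoLevelMinus`), then `MasterFamilyNonneg 3` — `E_3(μ_p; 1_{U_0},1_{U_1},1_{U_2}) ≥ 0`
for all increasing events and all product measures (Kahn's Conjecture 5).  The measure-level form of the M⁻-schema of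
prim-ineq-gen-4 g5 §II, formalised. [this work] -/
theorem masterFamilyNonneg_three_of_sahiTwoLevelMinus (h : SahiTwoLevelMinus) : MasterFamilyNonneg 3 :=
  masterFamilyNonneg_three_of_logDerivEnd_nonneg fun _ _ q V hV a _ _ => logDerivEnd_nonneg_of_sahiTwoLevelMinus h q V hV a

/-- **C₃-M⁻ ⟹ Kahn's Conjecture 5.** [this work] -/
theorem kahnConjecture_of_sahiTwoLevelMinus (h : SahiTwoLevelMinus) : KahnConjecture :=
  masterFamilyNonneg_three_iff_kahnConjecture.1 (masterFamilyNonneg_three_of_sahiTwoLevelMinus h)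

/-- **C₃-M⁺ (the top two-level law) ⟹ Sahi's `C_3` on product measures.** [this work] -/
theorem masterFamilyNonneg_three_of_sahiTwoLevelPlus (h : SahiTwoLevelPlus) : MasterFamilyNonneg 3 :=
  masterFamilyNonneg_three_of_sahiTwoLevelMinus (sahiTwoLevelMinus_of_plus h)

/-- **C₃-M⁺ ⟹ Kahn's Conjecture 5.** [this work] -/
theorem kahnConjecture_of_sahiTwoLevelPlus (h : SahiTwoLevelPlus) : KahnConjecture :=
  kahnConjecture_of_sahiTwoLevelMinus (sahiTwoLevelMinus_of_plus h)

/-- **C₃-M⁻ ⟹ `C_3` for DECREASING triples** (order duality; the percolation separation rows are down-sets). [this work] -/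
theorem masterFamilyNonnegLower_three_of_sahiTwoLevelMinus (h : SahiTwoLevelMinus) : MasterFamilyNonnegLower 3 :=
  (masterFamilyNonnegLower_iff 3).2 (masterFamilyNonneg_three_of_sahiTwoLevelMinus h)

end Summit.CriticalPhenomena.PercolationContinuityZ3.Theorems
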